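import Literature.AnabelianGeometry.SemiGraphs.TemperedPiCharacteristicTower
import Literature.AnabelianGeometry.SemiGraphs.TemperedCurveTowerOfSpecialFibreTower
import Literature.AnabelianGeometry.SemiGraphs.ArithTowerCharacteristicLevels
import Literature.AnabelianGeometry.SemiGraphs.GaloisLevelDataOfCharCoresFaithful
import Literature.AnabelianGeometry.SemiGraphs.TemperedEdgeLikeIsInfVerticialHolds
import Literature.AnabelianGeometry.SemiGraphs.TemperedPiTowerNonabelianLevel
import Literature.AnabelianGeometry.SemiGraphs.TemperedPiTowerOfGaloisSeq
import HarnessLib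

/-!
# The CHARACTERISTIC André tower of `π₁^temp(𝒢)` (every chart), and the Ex. 3.10 bridge with its
# model residual discharged ([SemiAnbd] Prop. 3.6 p. 38, Ex. 3.10 pp. 44–45; [André 2003] §4.5)

Mochizuki, *Semi-graphs of anabelioids*, Publ. RIMS **42** (2006) [SemiAnbd], Prop. 3.6 p. 38
("`π₁^temp(𝒢) := lim_i Gal(𝒢_{∞,i}/𝒢)` … independent, up to inner automorphism, of the choice of
cofinal system"), Ex. 3.10 p. 44 l. 9 ("an exhaustive sequence of open characteristic … subgroups"),
Thm. 3.7 (iii) p. 41. [cite: MochizukiSemiAnbd2006, Prop 3.6 p.38]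

PROOF-ONLY file (abc-iut cell, prover abc-iut-w5-d240; no definitions, no instances, no named facts):
second half of GAP-LEDGER row **G-w5d240-1** — the model residual B1′ of the Ex. 3.10 bridge
`TemperedCurve.tower_of_specialFibreTower` (p448568) — at the CHARACTERISTIC Galois tower
`GaloisLevelData.ofCharCores` (seats abc-iut-w4-d048/w4-d053/L3-t9; levels the Galois coverings whose
`π̂₁`-stabilisers are the characteristic open cores of `π̂₁(𝒢) = Aut(𝒢.fiberAt v₀)`):

* `ofCharCores_map_ker_projAut_eq` — every topological-group automorphism of the tower's tempered
  group fixes every tree level `Ker ρ_k`: the finite levels are characteristic open cores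
  (`ker_piLevelAut_ofGaloisSeq_eq_charOpenCore` + `stabilizer_eq_charOpenCore_of_charCoreObj`), and
  `TemperedPiCharacteristicTower.map_ker_projAut_eq_of_map_ker_piLevelAut_eq`;
* `ofCharCores_exists_not_commute` — for `𝔾` finite with a closed edge, the deck groups `π₁(𝔾_k)` of
  the characteristic levels are non-abelian for `k ≫ 0` (they dominate abc-iut-L3-t9's enumerated tower,
  `ofCharCores_dominates`, which eventually dominates the elevation approximators,
  `galoisLevelData_eventually_dominates`; then the count `CovObj.cyclomatic_count`, p439910);
* `ofCharCores_charTower` — **the characteristic André tower** of the tower's tempered group: cofinal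
  open normal `Ker ρ_k`, fixed by every topological-group automorphism, with quotient containing a
  free, normal, finite-index, finite-rank, non-abelian subgroup;
* `charTower_of_continuousMulEquiv`, **`TemperedPiChart.charTower`** — transport to EVERY chart
  (Prop. 3.2 / `exists_compatIso`): for `𝒢` satisfying the hypotheses of Prop. 3.6, finite, with
  topologically finitely generated constituents and a closed edge, every `c.G` has a characteristic
  André tower — the binder `hch` of the bridge; `TemperedPiChart.charTower_of_coherent` (coherence ⇒
  t.f.g. constituents);
* **`TemperedCurve.tower_of_specialFibreTower_of_finite`** — the Ex. 3.10 bridge with (B1′)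
  DISCHARGED: `htower₀` for `Π^temp_{X_K}` from a special-fibre tower over `Δ^temp_X` + (P0) + (h1),
  provided the fibres `𝒢_i` are finite, coherent, with a closed edge (as are the dual semi-graphs of
  stable curves with singular special fibre).

Classical material over the cell's [SemiAnbd] §3 formalisation; nothing here bears on [IUTchIII]
Cor. 3.12 or takes a side on any disputed claim.
-/

noncomputable section

namespace Literature.AnabelianGeometry.SemiGraphs

open CategoryTheory CategoryTheory.PreGaloisCategory _root_.Topology Literature.AnabelianGeometry.Anabelioids
open Literature.AnabelianGeometry.AbsoluteAnabelian (IsTopologicallyFinitelyGenerated)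
open Literature.GroupTheory.CombinatorialGroupTheory
open scoped Pointwise

universe u

/-! ### 0. Transport of characteristic André towers along topological-group isomorphisms -/

section Transport

variable {P P' : Type u} [Group P] [TopologicalSpace P] [Group P'] [TopologicalSpace P']

/-- **A characteristic André tower transports along an isomorphism of topological groups**: the
image `e(M)` of an open normal subgroup fixed by every topological-group automorphism of `P` is fixed
by every topological-group automorphism `φ'` of `P'` (conjugate `φ'` back to `e⁻¹ φ' e`), and the
quotient structure transports (`QuotientGroup.congr`). [cite: MochizukiSemiAnbd2006, Prop 3.6 p.38] -/
theorem charTower_of_continuousMulEquiv (e : P ≃ₜ* P')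
    (h : ∀ V ∈ 𝓝 (1 : P), ∃ M : OpenNormalSubgroup P, (M : Set P) ⊆ V ∧
      (∀ φ : P ≃ₜ* P, M.toSubgroup.map φ.toMulEquiv.toMonoidHom ≤ M.toSubgroup) ∧
      ∃ (G : Subgroup (P ⧸ M.toSubgroup)) (_ : IsFreeGroup G), G.Normal ∧ G.FiniteIndex ∧
        Finite (IsFreeGroup.Generators G) ∧ ∃ a ∈ G, ∃ b ∈ G, a * b ≠ b * a) :
    ∀ V ∈ 𝓝 (1 : P'), ∃ M : OpenNormalSubgroup P', (M : Set P') ⊆ V ∧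
      (∀ φ : P' ≃ₜ* P', M.toSubgroup.map φ.toMulEquiv.toMonoidHom ≤ M.toSubgroup) ∧
      ∃ (G : Subgroup (P' ⧸ M.toSubgroup)) (_ : IsFreeGroup G), G.Normal ∧ G.FiniteIndex ∧
        Finite (IsFreeGroup.Generators G) ∧ ∃ a ∈ G, ∃ b ∈ G, a * b ≠ b * a := by
  intro V hV
  have hU : e ⁻¹' V ∈ 𝓝 (1 : P) := by
    apply e.continuous.continuousAt.preimage_mem_nhds
    simpa using hV
  obtain ⟨M, hMU, hchar, hG⟩ := h _ hU
  haveI : M.toSubgroup.Normal := M.isNormal'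
  let M' : OpenNormalSubgroup P' :=
    { toSubgroup := M.toSubgroup.comap (e.symm : P' →* P)
      isOpen' := M.toOpenSubgroup.isOpen.preimage e.symm.continuous
      isNormal' := inferInstance }
  refine ⟨M', fun x hx => ?_, fun φ => ?_, ?_⟩
  · have h1 : e.symm x ∈ e ⁻¹' V := hMU hx
    simpa using h1
  · -- `e⁻¹ φ e` fixes `M`, hence `φ` fixes `e(M) = e.symm⁻¹(M)`
    rintro _ ⟨x, hx, rfl⟩
    let ψ : P ≃ₜ* P := e.trans (φ.trans e.symm)
    have hψ : ψ.toMulEquiv.toMonoidHom (e.symm x) ∈ M.toSubgroup := hchar ψ ⟨e.symm x, hx, rfl⟩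
    have hcalc : ψ.toMulEquiv.toMonoidHom (e.symm x) = e.symm (φ x) := by
      change e.symm (φ (e (e.symm x))) = e.symm (φ x)
      rw [ContinuousMulEquiv.apply_symm_apply]
    change e.symm (φ.toMulEquiv.toMonoidHom x) ∈ M.toSubgroup
    rw [hcalc] at hψ
    exact hψ
  · haveI : M'.toSubgroup.Normal := M'.isNormal'
    have he : M'.toSubgroup.map (e.symm : P' ≃* P) = M.toSubgroup :=
      Subgroup.map_comap_eq_self_of_surjective e.symm.surjective _
    let ē : P' ⧸ M'.toSubgroup ≃* P ⧸ M.toSubgroup :=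
      QuotientGroup.congr M'.toSubgroup M.toSubgroup (e.symm : P' ≃* P) he
    exact exists_free_normal_finiteIndex_of_mulEquiv ē.symm hG

end Transport

namespace ProfiniteSemiGraph

/-! ### 1. The characteristic Galois tower `ofCharCores`: its levels, kernels, deck groups -/

section CharCores

variable {𝒢 : ProfiniteSemiGraph.{u}} [Finite 𝒢.graph.Vertex] [Finite 𝒢.graph.Branch]
  (h36 : 𝒢.Prop36Hypotheses) (v₀ : 𝒢.graph.Vertex)
  (hVt : ∀ v : 𝒢.graph.Vertex, IsTopologicallyFinitelyGenerated (𝒢.Gv v))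
  (hEt : ∀ e : 𝒢.graph.Edge, IsTopologicallyFinitelyGenerated (𝒢.Ge e))

/-- The characteristic levels split themselves (abc-iut-L3-t9's `ofGaloisSeq_splits_self`).
[cite: MochizukiSemiAnbd2006, Prop 3.6 p.38] -/
private theorem charCores_splits_self (n : ℕ) :
    ((GaloisLevelData.ofCharCores h36 v₀ hVt hEt).S n).Splits ((GaloisLevelData.ofCharCores h36 v₀ hVt hEt).S n) :=
  GaloisLevelData.ofGaloisSeq_splits_self (𝒢 := 𝒢) (hc := h36.isConnected) (v₀ := v₀)
    (A := charCoreObj h36 v₀ hVt hEt) (hA := isGalois_charCoreObj h36 v₀ hVt hEt)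
    (f := seqHom h36.isConnected v₀ (fun k => charOpenCore (Aut (𝒢.fiberAt v₀)) k)
      (isOpen_charOpenCore_autFiberAt h36 v₀ hVt hEt) (finiteIndex_charOpenCore_autFiberAt h36 v₀ hVt hEt)
      (fun _ _ h => charOpenCore_anti h)) n

/-- The characteristic levels are finite coverings (abc-iut-L3-t9's `ofGaloisSeq_isFinite`).
[cite: MochizukiSemiAnbd2006, Prop 3.6 p.38] -/
private theorem charCores_isFinite (n : ℕ) : ((GaloisLevelData.ofCharCores h36 v₀ hVt hEt).S n).IsFinite :=
  GaloisLevelData.ofGaloisSeq_isFinite (𝒢 := 𝒢) (hc := h36.isConnected) (v₀ := v₀)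
    (A := charCoreObj h36 v₀ hVt hEt) (hA := isGalois_charCoreObj h36 v₀ hVt hEt)
    (f := seqHom h36.isConnected v₀ (fun k => charOpenCore (Aut (𝒢.fiberAt v₀)) k)
      (isOpen_charOpenCore_autFiberAt h36 v₀ hVt hEt) (finiteIndex_charOpenCore_autFiberAt h36 v₀ hVt hEt)
      (fun _ _ h => charOpenCore_anti h)) n

/-- The characteristic levels have nonempty fibres (abc-iut-L3-t9's `ofGaloisSeq_hasNonemptyFibres`).
[cite: MochizukiSemiAnbd2006, Prop 3.6 p.38] -/
private theorem charCores_hasNonemptyFibres (n : ℕ) :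
    ((GaloisLevelData.ofCharCores h36 v₀ hVt hEt).S n).HasNonemptyFibres :=
  GaloisLevelData.ofGaloisSeq_hasNonemptyFibres (𝒢 := 𝒢) (hc := h36.isConnected) (v₀ := v₀)
    (A := charCoreObj h36 v₀ hVt hEt) (hA := isGalois_charCoreObj h36 v₀ hVt hEt)
    (f := seqHom h36.isConnected v₀ (fun k => charOpenCore (Aut (𝒢.fiberAt v₀)) k)
      (isOpen_charOpenCore_autFiberAt h36 v₀ hVt hEt) (finiteIndex_charOpenCore_autFiberAt h36 v₀ hVt hEt)
      (fun _ _ h => charOpenCore_anti h)) n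

/-- Fibre-rigidity of the endomorphisms of the characteristic levels (connected Galois objects).
[cite: MochizukiSemiAnbd2006, Prop 3.6 p.38] -/
private theorem charCores_hrigid (n : ℕ)
    (σ σ' : (GaloisLevelData.ofCharCores h36 v₀ hVt hEt).S n ⟶ (GaloisLevelData.ofCharCores h36 v₀ hVt hEt).S n)
    (h : (σ.fV (GaloisLevelData.ofCharCores h36 v₀ hVt hEt).v₀).hom.hom
        ((GaloisLevelData.ofCharCores h36 v₀ hVt hEt).x n) =
      (σ'.fV (GaloisLevelData.ofCharCores h36 v₀ hVt hEt).v₀).hom.hom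
        ((GaloisLevelData.ofCharCores h36 v₀ hVt hEt).x n)) : σ = σ' :=
  letI := SemiGraphOfAnabelioids.galoisCategory_bObj 𝒢.toAnab ⟨h36.isConnected⟩
  𝒢.hrigid_ofBObj_of_isConnected h36.isConnected (charCoreObj h36 v₀ hVt hEt n)
    (isGalois_charCoreObj h36 v₀ hVt hEt n).toIsConnected _ _ σ σ' h

/-- **The finite levels of the characteristic tower are characteristic open cores of ITS tempered
group**: `Ker π_k = charOpenCore (π₁^temp) k` (abc-iut-L3-t9's `ker_piLevelAut_ofGaloisSeq_eq_charOpenCore`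
with the point stabilisers `stabilizer_eq_charOpenCore_of_charCoreObj`).
[cite: MochizukiSemiAnbd2006, Prop 3.6(iii) p.38] -/
theorem ofCharCores_ker_piLevelAut_eq_charOpenCore (k : ℕ) :
    ((GaloisLevelData.ofCharCores h36 v₀ hVt hEt).piLevelAut h36.isCountable
        (ofCharCores_sameComponent h36 v₀ hVt hEt) k).ker =
      charOpenCore ((GaloisLevelData.ofCharCores h36 v₀ hVt hEt).temperedPi h36.isCountable) k :=
  𝒢.ker_piLevelAut_ofGaloisSeq_eq_charOpenCore h36 v₀ (charCoreObj h36 v₀ hVt hEt)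
    (isGalois_charCoreObj h36 v₀ hVt hEt)
    (seqHom h36.isConnected v₀ (fun k => charOpenCore (Aut (𝒢.fiberAt v₀)) k)
      (isOpen_charOpenCore_autFiberAt h36 v₀ hVt hEt) (finiteIndex_charOpenCore_autFiberAt h36 v₀ hVt hEt)
      (fun _ _ h => charOpenCore_anti h))
    (ofCharCores_exists_level_splits_component h36 v₀ hVt hEt) k k
    (stabilizer_eq_charOpenCore_of_charCoreObj h36 v₀ hVt hEt k)

/-- **Every topological-group automorphism of the characteristic tower's tempered group fixes every
tree level `Ker ρ_k`** (finite levels are characteristic open cores, `map_charOpenCore_eq`; then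
`map_ker_projAut_eq_of_map_ker_piLevelAut_eq`). [cite: MochizukiSemiAnbd2006, Prop 3.6 p.38] -/
theorem ofCharCores_map_ker_projAut_eq
    (α : (GaloisLevelData.ofCharCores h36 v₀ hVt hEt).temperedPi h36.isCountable ≃ₜ*
      (GaloisLevelData.ofCharCores h36 v₀ hVt hEt).temperedPi h36.isCountable) (k : ℕ) :
    (((GaloisLevelData.ofCharCores h36 v₀ hVt hEt).projAut h36.isCountable k).ker).map
        α.toMulEquiv.toMonoidHom =
      ((GaloisLevelData.ofCharCores h36 v₀ hVt hEt).projAut h36.isCountable k).ker := by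
  let D := GaloisLevelData.ofCharCores h36 v₀ hVt hEt
  have T : ∀ w : 𝒢.graph.Vertex, D.PointSeq h36.isCountable w := fun w =>
    (GaloisLevelData.nonempty_pointSeq_of_isConnected D h36.isCountable h36.isConnected w).some
  obtain ⟨R⟩ := SemiGraph.nonempty_refBranches_of_isConnected 𝒢.graph h36.isConnected v₀
  refine D.map_ker_projAut_eq_of_map_ker_piLevelAut_eq h36.isCountable
    (ofCharCores_sameComponent h36 v₀ hVt hEt) T R α k ?_
  rw [ofCharCores_ker_piLevelAut_eq_charOpenCore h36 v₀ hVt hEt k]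
  exact map_charOpenCore_eq α.toMulEquiv α.continuous α.symm.continuous

variable [Finite 𝒢.graph.Edge]

/-- **The deck groups of the characteristic levels are eventually non-abelian** when `𝔾` has a closed
edge: the characteristic tower dominates abc-iut-L3-t9's enumerated tower (`ofCharCores_dominates`),
which eventually dominates the elevation approximators at every vertex
(`galoisLevelData_eventually_dominates`), so the cyclomatic count (`CovObj.cyclomatic_count`) applies
at every characteristic level from some level on. [cite: MochizukiSemiAnbd2006, Prop 3.6 p.38] -/
theorem ofCharCores_exists_not_commute (hcl : ∃ e : 𝒢.graph.Edge, 𝒢.graph.IsClosedEdge e) :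
    ∃ k₀ : ℕ, ∀ k, k₀ ≤ k →
      ∃ a b : ((GaloisLevelData.ofCharCores h36 v₀ hVt hEt).S k).orbitGraph.FundamentalGroup
        (((GaloisLevelData.ofCharCores h36 v₀ hVt hEt).S k).baseComp
          (GaloisLevelData.ofCharCores h36 v₀ hVt hEt).v₀ ((GaloisLevelData.ofCharCores h36 v₀ hVt hEt).x k)),
        a * b ≠ b * a := by
  classical
  let D := GaloisLevelData.ofCharCores h36 v₀ hVt hEt
  letI : Fintype 𝒢.graph.Vertex := Fintype.ofFinite _
  obtain ⟨e₀, he₀⟩ := hcl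
  have hve := SemiGraph.exists_abuts_isClosedEdge h36.isConnected he₀
  -- elevation approximators of order `> #vertices` and a level of the enumerated tower dominating them
  have hel := fun v => h36.isTotallyElevated v (Nat.card 𝒢.graph.Vertex + 1)
  choose A hepi N hMN hNel using hel
  choose i hi using fun v => 𝒢.galoisLevelData_eventually_dominates h36 (A v)
  let n : ℕ := Finset.univ.sup i
  have hn : ∀ v, i v ≤ n := fun v => Finset.le_sup (Finset.mem_univ v)
  -- a characteristic level dominating that level, and all deeper characteristic levels
  obtain ⟨k₀, f₀, -⟩ := ofCharCores_dominates h36 v₀ hVt hEt n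
  refine ⟨k₀, fun k hk => ?_⟩
  obtain ⟨t⟩ := D.nonempty_hom_of_le hk
  let f : D.S k ⟶ (𝒢.galoisLevelData h36).S n := t ≫ f₀
  have hS : (D.S k).IsFinite := charCores_isFinite h36 v₀ hVt hEt k
  haveI : Finite (D.S k).orbitGraph.Vertex := (D.S k).finite_oVertex hS
  haveI : Finite (D.S k).orbitGraph.Edge := (D.S k).finite_oEdge hS
  haveI : Finite (D.S k).orbitGraph.Branch := (D.S k).finite_orbitGraph_branch hS
  refine SemiGraph.exists_not_commute_fundamentalGroup (D.S k).orbitGraph _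
    (D.nonempty_hom_baseComp_of_sameComponent k (ofCharCores_sameComponent h36 v₀ hVt hEt k)) ?_
  refine (D.S k).cyclomatic_count hS h36.isConnected D.v₀ (D.x k) hve fun v =>
    ⟨A v, (hepi v).1 v, ⟨N v, hMN v, hNel v⟩, fun x p hpx => hi v n (hn v) v ((f.fV v).hom.hom x) p ?_⟩
  rw [← CovHom.fV_ρ f v p x, hpx]

/-- **The CHARACTERISTIC André tower of the characteristic Galois tower's tempered group**: for `𝒢`
finite, satisfying the hypotheses of Prop. 3.6, with topologically finitely generated constituents and
a closed edge, the tree levels `Ker ρ_k` of `GaloisLevelData.ofCharCores` are cofinal open normal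
subgroups, FIXED BY EVERY TOPOLOGICAL-GROUP AUTOMORPHISM, whose quotients contain a free, normal,
finite-index, finite-rank, non-abelian subgroup. [cite: MochizukiSemiAnbd2006, Prop 3.6 p.38] -/
theorem ofCharCores_charTower (hcl : ∃ e : 𝒢.graph.Edge, 𝒢.graph.IsClosedEdge e) :
    ∀ V ∈ 𝓝 (1 : (GaloisLevelData.ofCharCores h36 v₀ hVt hEt).temperedPi h36.isCountable),
      ∃ M : OpenNormalSubgroup ((GaloisLevelData.ofCharCores h36 v₀ hVt hEt).temperedPi h36.isCountable),
        (M : Set ((GaloisLevelData.ofCharCores h36 v₀ hVt hEt).temperedPi h36.isCountable)) ⊆ V ∧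
        (∀ φ : (GaloisLevelData.ofCharCores h36 v₀ hVt hEt).temperedPi h36.isCountable ≃ₜ*
            (GaloisLevelData.ofCharCores h36 v₀ hVt hEt).temperedPi h36.isCountable,
          M.toSubgroup.map φ.toMulEquiv.toMonoidHom ≤ M.toSubgroup) ∧
        ∃ (G : Subgroup (_ ⧸ M.toSubgroup)) (_ : IsFreeGroup G), G.Normal ∧ G.FiniteIndex ∧
          Finite (IsFreeGroup.Generators G) ∧ ∃ a ∈ G, ∃ b ∈ G, a * b ≠ b * a := by
  let D := GaloisLevelData.ofCharCores h36 v₀ hVt hEt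
  have hconn := ofCharCores_sameComponent h36 v₀ hVt hEt
  obtain ⟨k₀, hk₀⟩ := ofCharCores_exists_not_commute h36 v₀ hVt hEt hcl
  intro V hV
  obtain ⟨m, hm⟩ := D.exists_ker_projAut_subset h36.isCountable hV
  let k := max m k₀
  let M : OpenNormalSubgroup (D.temperedPi h36.isCountable) :=
    { toSubgroup := (D.projAut h36.isCountable k).ker
      isOpen' := D.isOpen_ker_projAut h36.isCountable k
      isNormal' := inferInstance }
  refine ⟨M, fun x hx => hm (D.ker_projAut_anti h36.isCountable (le_max_left m k₀) hx),
    fun φ => (ofCharCores_map_ker_projAut_eq h36 v₀ hVt hEt φ k).le, ?_⟩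
  exact D.exists_free_quotient_ker_projAut h36.isCountable k (charCores_hrigid h36 v₀ hVt hEt k)
    ((charCores_isFinite h36 v₀ hVt hEt k).finite_V _)
    (D.deckGroup_finite_rank_of_sameComponent (charCores_isFinite h36 v₀ hVt hEt) hconn k)
    (hk₀ k (le_max_right m k₀))

end CharCores

section EveryChart

variable {𝒢 : ProfiniteSemiGraph.{u}}

/-! ### 2. Every chart -/

/-- **[SemiAnbd] Prop. 3.6 / [André 2003] §4.5 — the CHARACTERISTIC André tower of `π₁^temp(𝒢)`, for
EVERY chart.**  Let `𝒢` satisfy the hypotheses of Prop. 3.6 with finitely many vertices and edges,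
topologically finitely generated vertex and edge groups, and a closed edge.  Then the group `c.G` of
every tempered fundamental group chart has, inside every neighbourhood of `1`, an open normal subgroup
FIXED BY EVERY TOPOLOGICAL-GROUP AUTOMORPHISM of `c.G` whose quotient contains a free, normal,
finite-index, finite-rank, non-abelian subgroup (transport from the characteristic tower's own chart,
`GaloisLevelData.chart`, along Prop. 3.2 `exists_compatIso`).  This is the binder `hch` of the Ex. 3.10
bridge `TemperedCurve.tower_of_specialFibreTower` (GAP-LEDGER G-w5d240-1).
[cite: MochizukiSemiAnbd2006, Prop 3.6 p.38] -/
theorem TemperedPiChart.charTower [Finite 𝒢.graph.Vertex] [Finite 𝒢.graph.Edge] [Finite 𝒢.graph.Branch]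
    (c : TemperedPiChart 𝒢) (h36 : 𝒢.Prop36Hypotheses)
    (hVt : ∀ v : 𝒢.graph.Vertex, IsTopologicallyFinitelyGenerated (𝒢.Gv v))
    (hEt : ∀ e : 𝒢.graph.Edge, IsTopologicallyFinitelyGenerated (𝒢.Ge e))
    (hcl : ∃ e : 𝒢.graph.Edge, 𝒢.graph.IsClosedEdge e) :
    ∀ V ∈ 𝓝 (1 : c.G), ∃ M : OpenNormalSubgroup c.G, (M : Set c.G) ⊆ V ∧
      (∀ φ : c.G ≃ₜ* c.G, M.toSubgroup.map φ.toMulEquiv.toMonoidHom ≤ M.toSubgroup) ∧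
      ∃ (G : Subgroup (c.G ⧸ M.toSubgroup)) (_ : IsFreeGroup G), G.Normal ∧ G.FiniteIndex ∧
        Finite (IsFreeGroup.Generators G) ∧ ∃ a ∈ G, ∃ b ∈ G, a * b ≠ b * a := by
  let v₀ : 𝒢.graph.Vertex := 𝒢.baseVertex h36
  let D := GaloisLevelData.ofCharCores h36 v₀ hVt hEt
  let c₀ : TemperedPiChart 𝒢 := D.chart h36.isCountable (ofCharCores_exists_level_splits_component h36 v₀ hVt hEt)
    h36.isConnected (charCores_splits_self h36 v₀ hVt hEt) (charCores_isFinite h36 v₀ hVt hEt)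
    (charCores_hasNonemptyFibres h36 v₀ hVt hEt)
  obtain ⟨φ, ψ, hψφ, hφψ, -, -⟩ := TemperedPiChart.exists_compatIso c₀ c
  let e : D.temperedPi h36.isCountable ≃ₜ* c.G :=
    ⟨⟨⟨φ, ψ, hψφ, hφψ⟩, fun x y => map_mul φ x y⟩, φ.continuous, ψ.continuous⟩
  exact charTower_of_continuousMulEquiv e (ofCharCores_charTower h36 v₀ hVt hEt hcl)

end EveryChart


section Coherent

variable {𝒢 : ProfiniteSemiGraph.{u}}

/-- **The characteristic André tower for every chart, from COHERENCE** (Def. 2.3 (iii): topologically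
finitely generated constituents) — the binder `hch` of the bridge in the hypotheses available at the
special fibres of a curve: `𝒢` finite, coherent, Prop. 3.6 hypotheses, a closed edge.
[cite: MochizukiSemiAnbd2006, Prop 3.6 p.38] -/
theorem TemperedPiChart.charTower_of_coherent [Finite 𝒢.graph.Vertex] [Finite 𝒢.graph.Edge]
    (c : TemperedPiChart 𝒢) (h36 : 𝒢.Prop36Hypotheses) (hcoh : 𝒢.IsCoherent)
    (hcl : ∃ e : 𝒢.graph.Edge, 𝒢.graph.IsClosedEdge e) :
    ∀ V ∈ 𝓝 (1 : c.G), ∃ M : OpenNormalSubgroup c.G, (M : Set c.G) ⊆ V ∧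
      (∀ φ : c.G ≃ₜ* c.G, M.toSubgroup.map φ.toMulEquiv.toMonoidHom ≤ M.toSubgroup) ∧
      ∃ (G : Subgroup (c.G ⧸ M.toSubgroup)) (_ : IsFreeGroup G), G.FiniteIndex ∧
        Finite (IsFreeGroup.Generators G) ∧ ∃ a ∈ G, ∃ b ∈ G, a * b ≠ b * a := by
  haveI : Finite 𝒢.graph.Branch := SemiGraph.finite_branch 𝒢.graph
  intro V hV
  obtain ⟨M, hMV, hchar, G, hG, -, hGfi, hGfin, hab⟩ :=
    c.charTower h36 (fun v => ⟨hcoh.2.1 v⟩) (fun e => ⟨hcoh.2.2 e⟩) hcl V hV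
  exact ⟨M, hMV, hchar, G, hG, hGfi, hGfin, hab⟩

end Coherent

end ProfiniteSemiGraph

/-! ### 3. The Ex. 3.10 bridge with its model residual discharged -/

namespace TemperedCurve

variable {p : ℕ} [Fact p.Prime] (X : TemperedCurve p)

/-- **[SemiAnbd] Ex. 3.10 — THE BRIDGE, model residual discharged.**  For `X : TemperedCurve p` with
`Π^temp_{X_K}` tempered and first countable, and a special-fibre tower `T` over `Δ^temp_X` whose fibres
`𝒢_i` are FINITE, COHERENT and carry a CLOSED EDGE (the dual semi-graphs of a stable curve with
singular special fibre), with (P0) `Π`-normal admissible kernels and (h1) the inverse-limit topology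
"`Δ = lim Δ[i]`" (p. 45 l. 10): `Π^temp_{X_K}` has the André tower property `htower₀` — cofinal open
normal `N` with `Π^temp_{X_K}/N` containing a free, normal, finite-index, finite-rank, non-abelian
subgroup — VERBATIM the input of the cell's [SemiAnbd] §6 / [EtTh] Lem. 2.17 (ii) discharges
(`TemperedCurve.tower_of_specialFibreTower` with its binder `hch` supplied by
`TemperedPiChart.charTower_of_coherent` at every level; GAP-LEDGER G-w5d240-1 closed at the model).
[cite: MochizukiSemiAnbd2006, Ex 3.10 pp.44-45] -/
theorem tower_of_specialFibreTower_of_finite (hT : IsTempered X.PiTemp) [FirstCountableTopology X.PiTemp]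
    (T : SpecialFibreTower X.DeltaTemp)
    (hP0 : ∀ i, ((T.admKer i).map X.DeltaTemp.subtype).Normal)
    (hlim : ∀ U ∈ 𝓝 (1 : X.DeltaTemp), ∃ i, ∃ V ∈ 𝓝 (1 : (T.chart i).G),
      ∀ n : T.N i, T.adm i n ∈ V → (n : X.DeltaTemp) ∈ U)
    (hfinV : ∀ i, Finite (T.Gc i).graph.Vertex) (hfinE : ∀ i, Finite (T.Gc i).graph.Edge)
    (hcoh : ∀ i, (T.Gc i).IsCoherent)
    (hcl : ∀ i, ∃ e : (T.Gc i).graph.Edge, (T.Gc i).graph.IsClosedEdge e) :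
    ∀ U ∈ 𝓝 (1 : X.PiTemp), ∃ N : OpenNormalSubgroup X.PiTemp, (N : Set X.PiTemp) ⊆ U ∧
      ∃ (G : Subgroup (X.PiTemp ⧸ N.toSubgroup)) (_ : IsFreeGroup G), G.Normal ∧ G.FiniteIndex ∧
        Finite (IsFreeGroup.Generators G) ∧ ∃ a ∈ G, ∃ b ∈ G, a * b ≠ b * a :=
  X.tower_of_specialFibreTower hT T hP0 hlim fun i => by
    haveI := hfinV i
    haveI := hfinE i
    exact (T.chart i).charTower_of_coherent (T.hyp i).toProp36Hypotheses (hcoh i) (hcl i)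

/-- The same under the parameter bundle `d : X.GroupLevelData` of ruling η′.
[cite: MochizukiSemiAnbd2006, Ex 3.10 pp.44-45] -/
theorem tower_of_specialFibreTower_of_finite' (d : X.GroupLevelData) (T : SpecialFibreTower X.DeltaTemp)
    (hP0 : ∀ i, ((T.admKer i).map X.DeltaTemp.subtype).Normal)
    (hlim : ∀ U ∈ 𝓝 (1 : X.DeltaTemp), ∃ i, ∃ V ∈ 𝓝 (1 : (T.chart i).G),
      ∀ n : T.N i, T.adm i n ∈ V → (n : X.DeltaTemp) ∈ U)
    (hfinV : ∀ i, Finite (T.Gc i).graph.Vertex) (hfinE : ∀ i, Finite (T.Gc i).graph.Edge)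
    (hcoh : ∀ i, (T.Gc i).IsCoherent)
    (hcl : ∀ i, ∃ e : (T.Gc i).graph.Edge, (T.Gc i).graph.IsClosedEdge e) :
    ∀ U ∈ 𝓝 (1 : X.PiTemp), ∃ N : OpenNormalSubgroup X.PiTemp, (N : Set X.PiTemp) ⊆ U ∧
      ∃ (G : Subgroup (X.PiTemp ⧸ N.toSubgroup)) (_ : IsFreeGroup G), G.Normal ∧ G.FiniteIndex ∧
        Finite (IsFreeGroup.Generators G) ∧ ∃ a ∈ G, ∃ b ∈ G, a * b ≠ b * a := by
  haveI := d.secondCountableTopology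
  exact X.tower_of_specialFibreTower_of_finite d.isTempered T hP0 hlim hfinV hfinE hcoh hcl

/-- The `Δ^temp_X`-form (composition with abc-iut-w5-d139's `deltaTemp_tower_of_tower_of_isTempered`).
[cite: MochizukiSemiAnbd2006, Ex 3.10 pp.44-45] -/
theorem deltaTemp_tower_of_specialFibreTower_of_finite (hT : IsTempered X.PiTemp)
    [FirstCountableTopology X.PiTemp] (T : SpecialFibreTower X.DeltaTemp)
    (hP0 : ∀ i, ((T.admKer i).map X.DeltaTemp.subtype).Normal)
    (hlim : ∀ U ∈ 𝓝 (1 : X.DeltaTemp), ∃ i, ∃ V ∈ 𝓝 (1 : (T.chart i).G),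
      ∀ n : T.N i, T.adm i n ∈ V → (n : X.DeltaTemp) ∈ U)
    (hfinV : ∀ i, Finite (T.Gc i).graph.Vertex) (hfinE : ∀ i, Finite (T.Gc i).graph.Edge)
    (hcoh : ∀ i, (T.Gc i).IsCoherent)
    (hcl : ∀ i, ∃ e : (T.Gc i).graph.Edge, (T.Gc i).graph.IsClosedEdge e) :
    ∀ U ∈ 𝓝 (1 : X.DeltaTemp), ∃ N : OpenNormalSubgroup X.DeltaTemp, (N : Set X.DeltaTemp) ⊆ U ∧
      ∃ (G : Subgroup (X.DeltaTemp ⧸ N.toSubgroup)) (_ : IsFreeGroup G), G.Normal ∧ G.FiniteIndex ∧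
        Finite (IsFreeGroup.Generators G) ∧ ∃ a ∈ G, ∃ b ∈ G, a * b ≠ b * a :=
  X.deltaTemp_tower_of_tower_of_isTempered hT
    (X.tower_of_specialFibreTower_of_finite hT T hP0 hlim hfinV hfinE hcoh hcl)

end TemperedCurve

end Literature.AnabelianGeometry.SemiGraphs

end
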